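import Literature.IUT.HodgeTheaters.ProfiniteCompletionSurfaceBasisCharacters
import Literature.GroupTheory.CombinatorialGroupTheory.SurfaceGroupHeisenbergLiftKernel
import HarnessLib

/-!
# [IUTchI] Lemma 2.7 (v), ORIENTABLE-SURFACE-GROUP HALF, modulo F_cov ONLY (F_res eliminated)

Mochizuki, *Inter-universal Teichmüller theory I*, kurims manuscript (May 2020), §2, Lemma 2.7 (v)
(statement p. 57, proof p. 59) [cite: Mochizuki2012, Lem 2.7(v) p.59] (D-0012 claim key, status disputed
— plain profinite group theory, no side taken).  Companion (proof-only, theorems only) of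
`ProfiniteCompletionSurfaceBasisCharacters.lean` (abc-iut-L5-t17), which proved the residual NO BASIS
CHARACTER for orientable surface groups, and hence the named statement
`FreeOrSurface.zHatQuotientNormallyTerminal` (Lemma 2.7 (v) AS TYPED, free + orientable-surface `G`),
MODULO two classical inputs on `S_g = ⟨a₁, b₁, …, a_g, b_g ∣ ∏ [aᵢ, bᵢ]⟩`:

* (F_cov) `SurfaceGroupFiniteIndexSubgroup` (the tree's NAMED FACT: a finite-index subgroup of `S_g`,
  `g ≥ 2`, is a surface group `S_h`, `h = j (g - 1) + 1`; Zieschang–Vogt–Coldewey 4.14.22 / 4.14.23), and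
* (F_res) the inline degree hypothesis `hR` ("restriction to a finite-index subgroup multiplies the
  Heisenberg / cup-product obstruction `ω` by `±` the index"; Brown III (9.5)(ii) with `PD²`).

THIS FILE REMOVES F_res.  In t17's route the hypothesis `hR` is used once: to see that the pair of
characters `Φ = ψ ∘ η ∘ e_H⁻¹ : S_h → 𝔽_p²` lifts to the extraspecial group of order `p³` after restriction
to `K = Ker χ_H`, the kernel of a NONTRIVIAL character `χ_H : S_h → 𝔽_p`.  That lifting holds for kernels
of characters by the cohomology-free argument of
`Literature.GroupTheory.CombinatorialGroupTheory.exists_extraspecial_lift_ker`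
(`SurfaceGroupHeisenbergLiftKernel.lean`: `Φ₁ ∪ Φ₂ = χ ∪ μ` in `H²(S_h; 𝔽_p)` for a suitable `μ`, on cocycles,
and `χ ∪ μ` dies on `Ker χ`) — no degree formula, no second appeal to F_cov.  Everything else is t17's
proof verbatim: `H = η⁻¹(U) ≅ S_h` (F_cov, used ONCE), the continuous extension `Π̂ : U → 𝔽_p^{2h}` of the
mod-`p` abelianisation, a nonzero linear form `λ` killing `Π̂ τ, Π̂ κ` (`2h ≥ 4 > 2`), `U' = Ker(λ ∘ Π̂) ∋ τ, κ`,
the lift on `η⁻¹(U')` extended to `U'` (`exists_extension_lift`), and the contradiction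
`false_of_lift_pair` (commuting `τ, κ` cannot lift `(1,0), (0,1)`).

Main results: `ProfiniteCompletion.noBasisCharacter_of_finiteIndexSubgroup (hF)` and
`FreeOrSurface.zHatQuotientNormallyTerminal_of_finiteIndexSubgroup (hF : SurfaceGroupFiniteIndexSubgroup) :
zHatQuotientNormallyTerminal` — the named statement of Lemma 2.7 (v) DISCHARGED MODULO F_cov alone;
it becomes unconditional when `SurfaceGroupFiniteIndexSubgroup` is discharged (abc-iut-L5-d3 / L5-t16,
Reidemeister–Schreier route).  Typed ≠ discharged beyond that.  Theorems only.
-/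

namespace Literature.IUT.HodgeTheaters

open CategoryTheory ProfiniteGrp ProfiniteGrp.ProfiniteCompletion Topology Multiplicative
open Literature.GroupTheory.CombinatorialGroupTheory

universe u

namespace ProfiniteCompletion

variable {G : Type u} [Group G]

/-- **NO BASIS CHARACTER for orientable surface groups, modulo F_cov only** (see the module docstring;
compared with `noBasisCharacter_of_surfaceFacts` the degree hypothesis `hR` = F_res is GONE: the
extraspecial lift on the kernel of the character `χ_H` is supplied by `exists_extraspecial_lift_ker`).
Conclusion: the inline statement consumed by `centralizer_le_of_zHat_of_noBasisCharacter` /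
`FreeOrSurface.zHatQuotientNormallyTerminal_of_surface_noBasisCharacter`.
[cite: Mochizuki2012, Lem 2.7(v) p.59] -/
theorem noBasisCharacter_of_finiteIndexSubgroup (hF : SurfaceGroupFiniteIndexSubgroup)
    (hG : IsOrientableSurfaceGroup G) :
    ∀ (p : ℕ), p.Prime → ∀ (U : Subgroup (profiniteCompletion G)),
      (∃ N₁ : FiniteIndexNormalSubgroup G, ∀ x : profiniteCompletion G, x.val N₁ = 1 → x ∈ U) →
      ∀ (ψ : U →* Multiplicative (ZMod p) × Multiplicative (ZMod p)),
      (∃ N₂ : FiniteIndexNormalSubgroup G,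
        ∀ (x : profiniteCompletion G) (hx : x ∈ U), x.val N₂ = 1 → ψ ⟨x, hx⟩ = 1) →
      ∀ (τ κ : profiniteCompletion G) (hτ : τ ∈ U) (hκ : κ ∈ U), τ * κ = κ * τ →
      ψ ⟨τ, hτ⟩ = (ofAdd 1, 1) → ψ ⟨κ, hκ⟩ = (1, ofAdd 1) → False := by
  classical
  intro p hp U hU1 ψ hψ1 τ κ hτ hκ hc hψτ hψκ
  haveI : Fact p.Prime := ⟨hp⟩
  haveI : NeZero p := ⟨hp.ne_zero⟩
  obtain ⟨N₁, hN₁⟩ := hU1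
  obtain ⟨N₂, hN₂⟩ := hψ1
  -- (1) `G ≅ S_g` in the `FourManifolds` presentation
  obtain ⟨g, hg2, ⟨e₁⟩⟩ := hG
  obtain ⟨bridge⟩ := exists_mulEquiv_surfaceGroup g
  let e₀ : G ≃* Literature.Topology.FourManifolds.SurfaceGroup g := e₁.trans bridge
  -- (2) the discrete subgroup `H = η⁻¹(U)`, of finite index, and `H ≅ S_h` by F_cov (the ONLY use)
  let H : Subgroup G := U.comap (toCompletion G)
  haveI hHfi : H.FiniteIndex := by
    apply Subgroup.finiteIndex_of_le (H := N₁.toSubgroup)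
    intro t ht
    change toCompletion G t ∈ U
    apply hN₁
    change (QuotientGroup.mk t : G ⧸ N₁.toSubgroup) = 1
    rw [QuotientGroup.eq_one_iff]
    exact ht
  let K₀ : Subgroup (Literature.Topology.FourManifolds.SurfaceGroup g) :=
    H.map (e₀ : G →* Literature.Topology.FourManifolds.SurfaceGroup g)
  have hK₀idx : K₀.index = H.index := Subgroup.index_map_equiv H e₀
  have hK₀fi : K₀.FiniteIndex := ⟨by rw [hK₀idx]; exact hHfi.index_ne_zero⟩
  obtain ⟨h, hh, ⟨e₂⟩⟩ := hF g hg2 K₀ hK₀fi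
  have hh2 : 2 ≤ h := two_le_genus_of_index hg2 hK₀fi.index_ne_zero hh
  let eH : H ≃* Literature.Topology.FourManifolds.SurfaceGroup h := (e₀.subgroupMap H).trans e₂
  -- the inclusion `ι : H → U`
  let ι : H →* U := ((toCompletion G).comp H.subtype).codRestrict U fun t => t.property
  -- (3) the mod-`p` abelianisation `π : S_h ↠ 𝔽_p^{2h}` and its continuous extension `Pih : U → 𝔽_p^{2h}`
  obtain ⟨π, hπsurj, -⟩ :=
    Literature.GroupTheory.CombinatorialGroupTheory.SurfaceGroup.exists_abelianizationModP h p
  obtain ⟨Pih, Nπ, hNπle, hPih⟩ := exists_extension N₁ hN₁ (π.comp eH.toMonoidHom)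
  have hPihι : ∀ t : H, Pih (ι t) = π (eH t) := fun t => hPih _ (ι t).2 t t.2 rfl
  -- (4) a nonzero linear form `lam` on `𝔽_p^{2h}` killing `Pih τ` and `Pih κ` (`2h ≥ 4 > 2`)
  have hdim : 2 < Module.finrank (ZMod p) (Literature.Topology.FourManifolds.surfaceGen h → ZMod p) := by
    rw [Module.finrank_fintype_fun_eq_card, Fintype.card_prod, Fintype.card_fin, Fintype.card_bool]
    omega
  obtain ⟨lam, hlam0, hlamτ, hlamκ⟩ :=
    exists_dual_ne_zero_vanishing_pair (K := ZMod p)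
      (W := Literature.Topology.FourManifolds.surfaceGen h → ZMod p) hdim
      (toAdd (Pih ⟨τ, hτ⟩)) (toAdd (Pih ⟨κ, hκ⟩))
  let χ : U →* Multiplicative (ZMod p) := (lam.toAddMonoidHom.toMultiplicative).comp Pih
  have hχ : ∀ x : U, χ x = ofAdd (lam (toAdd (Pih x))) := fun x => rfl
  -- (5) the open subgroup `U' = Ker χ ∋ τ, κ`
  let U' : Subgroup (profiniteCompletion G) := χ.ker.map U.subtype
  have hU'le : U' ≤ U := Subgroup.map_subtype_le _
  have hmemU' : ∀ (x : profiniteCompletion G) (hx : x ∈ U), χ ⟨x, hx⟩ = 1 → x ∈ U' :=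
    fun x hx h1 => ⟨⟨x, hx⟩, h1, rfl⟩
  have hU'mem : ∀ (x : profiniteCompletion G) (hx' : x ∈ U'), χ ⟨x, hU'le hx'⟩ = 1 := by
    rintro x ⟨y, hy, rfl⟩
    exact hy
  have hτ' : τ ∈ U' := hmemU' τ hτ (by rw [hχ, hlamτ, ofAdd_zero])
  have hκ' : κ ∈ U' := hmemU' κ hκ (by rw [hχ, hlamκ, ofAdd_zero])
  have hU'1 : ∃ N : FiniteIndexNormalSubgroup G, ∀ x : profiniteCompletion G, x.val N = 1 → x ∈ U' := by
    refine ⟨Nπ, fun x hx => ?_⟩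
    have hxU : x ∈ U := hN₁ x (val_eq_one_of_le x hNπle hx)
    refine hmemU' x hxU ?_
    have h1 : Pih ⟨x, hxU⟩ = 1 := by
      have := hPih x hxU 1 H.one_mem hx
      rw [this, show (⟨1, H.one_mem⟩ : H) = 1 from rfl, map_one]
    rw [hχ, h1, toAdd_one, map_zero, ofAdd_zero]
  let ψ' : U' →* Multiplicative (ZMod p) × Multiplicative (ZMod p) := ψ.comp (Subgroup.inclusion hU'le)
  have hψ'1 : ∃ N : FiniteIndexNormalSubgroup G,
      ∀ (x : profiniteCompletion G) (hx : x ∈ U'), x.val N = 1 → ψ' ⟨x, hx⟩ = 1 :=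
    ⟨N₂, fun x hx hxN => hN₂ x (hU'le hx) hxN⟩
  -- (6) the discrete side of `U'`: `χH = χ ∘ ι`, a NONTRIVIAL character, transported to `S_h`
  let χH : H →* Multiplicative (ZMod p) := χ.comp ι
  have hχHne : χH ≠ 1 := by
    obtain ⟨w, hw⟩ : ∃ w, lam w ≠ 0 := by
      by_contra hall
      push Not at hall
      exact hlam0 (LinearMap.ext hall)
    obtain ⟨s, hs⟩ := hπsurj (ofAdd w)
    obtain ⟨t, rfl⟩ := eH.surjective s
    intro hone
    have ht : χH t = 1 := by rw [hone, MonoidHom.one_apply]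
    change χ (ι t) = 1 at ht
    rw [hχ, hPihι, hs, toAdd_ofAdd, ofAdd_eq_one] at ht
    exact hw ht
  let χS : Literature.Topology.FourManifolds.SurfaceGroup h →* Multiplicative (ZMod p) :=
    χH.comp eH.symm.toMonoidHom
  have hχSne : χS ≠ 1 := by
    intro hone
    apply hχHne
    ext t
    have := DFunLike.congr_fun hone (eH t)
    rw [MonoidHom.one_apply] at this ⊢
    rw [← this]
    change χH t = χH (eH.symm (eH t))
    rw [MulEquiv.symm_apply_apply]
  -- `Φ = ψ ∘ η ∘ eH⁻¹ : S_h → 𝔽_p²`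
  let Φ : Literature.Topology.FourManifolds.SurfaceGroup h →*
      Multiplicative (ZMod p) × Multiplicative (ZMod p) := (ψ.comp ι).comp eH.symm.toMonoidHom
  -- (7) lift `Φ|_{Ker χS}` to the extraspecial group (NO degree formula), transport to `η⁻¹(U')`,
  -- extend to `U'`
  obtain ⟨E, _, _, α, hE, -, hker⟩ :=
    Literature.GroupTheory.CombinatorialGroupTheory.exists_extraspecial_lift_ker p
  obtain ⟨θK, hθK⟩ := hker h Φ χS hχSne
  -- the discrete subgroup `η⁻¹(U')` and its map to `Ker χS`
  have hH'U : ∀ t : U'.comap (toCompletion G), (t : G) ∈ H := fun t => hU'le t.2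
  have hH'ker : ∀ t : U'.comap (toCompletion G), eH ⟨t, hH'U t⟩ ∈ χS.ker := by
    intro t
    rw [MonoidHom.mem_ker]
    change χH (eH.symm (eH ⟨t, hH'U t⟩)) = 1
    rw [MulEquiv.symm_apply_apply]
    exact hU'mem (toCompletion G t) t.2
  let j : U'.comap (toCompletion G) →* χS.ker :=
    MonoidHom.mk' (fun t => ⟨eH ⟨t, hH'U t⟩, hH'ker t⟩) fun s t => by
      apply Subtype.ext
      change eH ⟨(s : G) * t, _⟩ = eH ⟨s, hH'U s⟩ * eH ⟨t, hH'U t⟩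
      rw [← map_mul]
      rfl
  let θ₀ : U'.comap (toCompletion G) →* E := θK.comp j
  have hθ₀ : ∀ t : U'.comap (toCompletion G), α (θ₀ t) = ψ' ⟨toCompletion G t, t.2⟩ := by
    intro t
    change α (θK (j t)) = ψ ⟨toCompletion G t, hU'le t.2⟩
    rw [hθK]
    change ψ (ι (eH.symm (eH ⟨t, hH'U t⟩))) = _
    rw [MulEquiv.symm_apply_apply]
    rfl
  obtain ⟨θ', hθ'⟩ := exists_extension_lift U' hU'1 α ψ' hψ'1 θ₀ hθ₀
  -- (8) contradiction: `τ, κ` commute but lift `(1,0)`, `(0,1)`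
  have hψ'τ : ψ' ⟨τ, hτ'⟩ = (ofAdd 1, 1) := by
    change ψ ⟨τ, hU'le hτ'⟩ = _
    exact hψτ
  have hψ'κ : ψ' ⟨κ, hκ'⟩ = (1, ofAdd 1) := by
    change ψ ⟨κ, hU'le hκ'⟩ = _
    exact hψκ
  exact false_of_lift_pair hτ' hκ' hc ψ' hψ'τ hψ'κ α hE θ' hθ'

end ProfiniteCompletion

/-! ### Lemma 2.7 (v), as typed, modulo F_cov only -/

namespace FreeOrSurface

/-- **Lemma 2.7 (v)** — the named statement `FreeOrSurface.zHatQuotientNormallyTerminal` for `G`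
free of finite rank OR an orientable surface group: a closed `T̂ ⊆ Ĝ` on which a continuous surjection
`Ĝ ↠ ℤ̂` is bijective is normally terminal — DISCHARGED MODULO the single classical input F_cov (the
tree's named fact `SurfaceGroupFiniteIndexSubgroup`); the degree hypothesis F_res of
`zHatQuotientNormallyTerminal_of_surfaceFacts` is no longer needed
(`ProfiniteCompletion.noBasisCharacter_of_finiteIndexSubgroup`).  The free half is unconditional
(`zHatQuotientNormallyTerminal_of_isFreeOfFiniteRank`).  CONDITIONAL theorem; typed ≠ discharged
for F_cov. [cite: Mochizuki2012, Lem 2.7(v) p.59] -/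
theorem zHatQuotientNormallyTerminal_of_finiteIndexSubgroup (hF : SurfaceGroupFiniteIndexSubgroup) :
    Literature.IUT.HodgeTheaters.FreeOrSurface.zHatQuotientNormallyTerminal.{u} :=
  zHatQuotientNormallyTerminal_of_surface_noBasisCharacter fun _ _ hG =>
    ProfiniteCompletion.noBasisCharacter_of_finiteIndexSubgroup hF hG

end FreeOrSurface

end Literature.IUT.HodgeTheaters
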